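import Summits.QuantumFields.QCD.Theorems.QuarksAsStableActionCriticalLineDiamagnetismRouteBAlgebraAux

/-!
# Helper stub `routeBAlgebra` of line `Sketch`: the Route B abstract chain (for stub `stub_heavyFrequencyGain`)
(crux `Summit.QuantumFields.QCD.Theses.QuarksAsStableAction.CriticalLineDiamagnetism`, item stmt-QuantumFields-9734,
static route for odd tori, Route B = reflection positivity in frequency land)

For positive definite one-step matrices `M_i` and unitary transporters `W_i` on the odd cycle `ZMod (2n+1)`
(`n ≥ 1`) and every reflection row `r`:
`(‖det (1 + ∏_{i<2n+1} M_i W_i)‖²)^n ≤ (p(M_{r+n}) · p(M_{r+n+1}))^n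
   · ∏_{t<n} Re det (1 + (W_{r+t}ᴴ M_{r+t} W_{r+t} M_{r+t+1})^n) · ∏_{t<n} Re det (1 + (W_uᴴ M_u W_u M_{u+1})^n)|_{u = r+n+1+t}`,
`p(M) = ∏ᵢ max(μᵢ(M), 1)`.

Proof (pure bookkeeping around tree facts):
* rotate the cyclic word to the row `r` (`det_one_add_prod_rotate`: `det (1 + XY) = det (1 + YX)` on the word split
  at `r`) and apply the mixed site/bond reflection Schwarz inequality `mixedSchwarzDet`:
  `‖det (1 + Ω)‖² ≤ ‖det (1 + word₊)‖ · ‖det (1 + word₋)‖`;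
* the `+` word is bounded by `routeBPlusChain` (closed-slab packaging + defect removal + the even-cycle chessboard
  estimate on Fock space + Sylvester):
  `‖det (1 + word₊)‖^n ≤ p(M_{r+n})^n ∏_{t<n} Re det (1 + (W_{r+t}ᴴ M_{r+t} W_{r+t} M_{r+t+1})^n)`;
* the `−` word is LITERALLY the `+` word of the reflected data `j ↦ M_{r−j}`, `j ↦ W_{r−1−j}ᴴ`
  (`wordMinus_eq_wordPlus`), so `routeBPlusChain` applies again; its pure tiling terms
  `det (1 + (W_u M_{u+1} W_uᴴ M_u)^n)`, `u = r − 1 − t`, are turned into `det (1 + (W_uᴴ M_u W_u M_{u+1})^n)` by the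
  cyclic Sylvester identity and re-indexed by `t ↦ n − 1 − t` (`u = r + n + 1 + (n − 1 − t)` in `ZMod (2n+1)`),
  and the pressure factor sits at `M_{r−n} = M_{r+n+1}` (`minusChain`).
Pure theorem file (no definitions).
-/

namespace Summit.QuantumFields.QCD.Cruxes.CriticalLineDiamagnetism.ChessboardCellGain

open Matrix
open scoped ComplexOrder MatrixOrder

namespace RouteBAlgebra

/-- Rotation invariance of `det (1 + ·)` of a cyclic word on `ZMod N`:
`det (1 + ∏_{i<N} f i) = det (1 + ∏_{i<N} f (r + i))` (split the word at `r` and use `det (1 + XY) = det (1 + YX)`). -/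
theorem det_one_add_prod_rotate {k : Type} [Fintype k] [DecidableEq k] {N : ℕ} [NeZero N]
    (f : ZMod N → Matrix k k ℂ) (r : ZMod N) :
    (1 + ((List.range N).map fun i : ℕ => f (i : ZMod N)).prod).det =
      (1 + ((List.range N).map fun i : ℕ => f (r + (i : ZMod N))).prod).det := by
  obtain ⟨r₀, hr₀, rfl⟩ : ∃ r₀ : ℕ, r₀ < N ∧ (r₀ : ZMod N) = r :=
    ⟨r.val, r.val_lt, ZMod.natCast_zmod_val r⟩
  have h1 : List.range N = List.range r₀ ++ (List.range (N - r₀)).map (r₀ + ·) := by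
    rw [← List.range_add, Nat.add_sub_cancel' hr₀.le]
  have h2 : List.range N = List.range (N - r₀) ++ (List.range r₀).map ((N - r₀) + ·) := by
    rw [← List.range_add, Nat.sub_add_cancel hr₀.le]
  conv_lhs => rw [h1]
  conv_rhs => rw [h2]
  rw [List.map_append, List.map_map, List.prod_append, List.map_append, List.map_map, List.prod_append,
    Matrix.det_one_add_mul_comm]
  congr 3
  · refine congrArg List.prod (List.map_congr_left fun i _ => ?_)
    simp only [Function.comp_apply, Nat.cast_add]
  · refine congrArg List.prod (List.map_congr_left fun i _ => ?_)
    simp only [Function.comp_apply, Nat.cast_add, Nat.cast_sub hr₀.le, ZMod.natCast_self]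
    congr 1
    ring

/-- A cyclic Sylvester identity for powers of a four-letter word: `det (1 + (A B C D)^p) = det (1 + (B C D A)^p)`. -/
theorem det_one_add_pow_rotate₄ {k : Type} [Fintype k] [DecidableEq k] (A B C D : Matrix k k ℂ) (p : ℕ) :
    (1 + (A * B * C * D) ^ p).det = (1 + (B * C * D * A) ^ p).det := by
  rw [Matrix.mul_assoc, Matrix.mul_assoc, det_one_add_pow_comm, ← Matrix.mul_assoc]

/-- The `−` reflected word at row `r` is literally the `+` reflected word of the reflected data
`j ↦ M (r − j)`, `j ↦ (W (r − 1 − j))ᴴ` (index bookkeeping on `ZMod (2n+1)`). -/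
theorem wordMinus_eq_wordPlus {k : Type} [Fintype k] [DecidableEq k] (n : ℕ)
    (M W : ZMod (2 * n + 1) → Matrix k k ℂ) (r : ZMod (2 * n + 1)) :
    ((List.range (2 * n + 1)).map fun i : ℕ =>
        M (r + (if 0 < (i : ZMod (2 * n + 1)).val ∧ (i : ZMod (2 * n + 1)).val ≤ n
          then -(i : ZMod (2 * n + 1)) else (i : ZMod (2 * n + 1)))) *
          (if (i : ZMod (2 * n + 1)).val < n then (W (r + (-1 - (i : ZMod (2 * n + 1)))))ᴴ
            else if (i : ZMod (2 * n + 1)).val = n then 1 else W (r + (i : ZMod (2 * n + 1))))) =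
      ((List.range (2 * n + 1)).map fun i : ℕ =>
        (fun j : ZMod (2 * n + 1) => M (r + -j))
            ((fun j : ZMod (2 * n + 1) => if j.val ≤ n then j else -j) (i : ZMod (2 * n + 1))) *
          (fun j : ZMod (2 * n + 1) => if j.val < n then (fun j : ZMod (2 * n + 1) => (W (r + (-1 - j)))ᴴ) j
            else if j.val = n then 1 else ((fun j : ZMod (2 * n + 1) => (W (r + (-1 - j)))ᴴ) (-1 - j))ᴴ)
            (i : ZMod (2 * n + 1))) := by
  refine List.map_congr_left fun i hi => ?_
  rw [List.mem_range] at hi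
  have hval : ((i : ZMod (2 * n + 1))).val = i := ZMod.val_cast_of_lt hi
  simp only [hval, sub_sub_cancel, conjTranspose_conjTranspose]
  congr 1
  by_cases h0 : i = 0
  · subst h0
    simp
  · by_cases hle : i ≤ n
    · rw [if_pos ⟨Nat.pos_of_ne_zero h0, hle⟩, if_pos hle]
    · rw [if_neg (fun h => hle h.2), if_neg hle, neg_neg]

/-- **The `−` half of the chain at row `r`**: the `+` chain `routeBPlusChain` for the reflected data, with the
pure tiling terms rewritten by cyclic Sylvester and re-indexed (`u = r − 1 − t ↔ r + n + 1 + (n − 1 − t)`). -/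
theorem minusChain {k : Type} [Fintype k] [DecidableEq k] (n : ℕ) (hn : 0 < n)
    (M : ZMod (2 * n + 1) → Matrix k k ℂ) (hM : ∀ i, (M i).PosDef)
    (W : ZMod (2 * n + 1) → Matrix k k ℂ) (hW : ∀ i, W i ∈ Matrix.unitaryGroup k ℂ) (r : ZMod (2 * n + 1)) :
    ‖(1 + ((List.range (2 * n + 1)).map fun i : ℕ =>
        M (r + (if 0 < (i : ZMod (2 * n + 1)).val ∧ (i : ZMod (2 * n + 1)).val ≤ n
          then -(i : ZMod (2 * n + 1)) else (i : ZMod (2 * n + 1)))) *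
          (if (i : ZMod (2 * n + 1)).val < n then (W (r + (-1 - (i : ZMod (2 * n + 1)))))ᴴ
            else if (i : ZMod (2 * n + 1)).val = n then 1 else W (r + (i : ZMod (2 * n + 1))))).prod).det‖ ^ n ≤
      (∏ i, max ((hM (r + n + 1)).posSemidef.1.eigenvalues i) 1) ^ n *
        ∏ t : Fin n, ((1 + ((W (r + n + 1 + t))ᴴ * M (r + n + 1 + t) * W (r + n + 1 + t) *
          M (r + n + 1 + t + 1)) ^ n).det).re := by
  have hW' : ∀ j : ZMod (2 * n + 1), (W (r + (-1 - j)))ᴴ ∈ Matrix.unitaryGroup k ℂ :=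
    fun j => Unitary.star_mem (hW _)
  have hQ := routeBPlusChain n hn (fun j => M (r + -j)) (fun j => hM (r + -j)) (fun j => (W (r + (-1 - j)))ᴴ) hW'
  rw [wordMinus_eq_wordPlus]
  refine hQ.trans (le_of_eq ?_)
  have hN : (2 * (n : ZMod (2 * n + 1)) + 1 = 0) := by exact_mod_cast ZMod.natCast_self (2 * n + 1)
  refine congrArg₂ (· * ·) ?_ ?_
  · have e0 : r + -(n : ZMod (2 * n + 1)) = r + n + 1 := by linear_combination -hN
    exact congrArg (fun x => (∏ i, max ((hM x).posSemidef.1.eigenvalues i) 1) ^ n) e0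
  · refine Fintype.prod_equiv Fin.revPerm _ _ fun t => ?_
    have ht : (t : ℕ) + 1 ≤ n := t.isLt
    rw [Fin.revPerm_apply, Fin.val_rev, Nat.cast_sub ht, conjTranspose_conjTranspose]
    have e1 : r + (n : ZMod (2 * n + 1)) + 1 + ((n : ZMod (2 * n + 1)) - (((t : ℕ) + 1 : ℕ) : ZMod (2 * n + 1))) =
        r + (-1 - ((t : ℕ) : ZMod (2 * n + 1))) := by
      push_cast
      linear_combination hN
    have e2 : r + -((t : ℕ) : ZMod (2 * n + 1)) = r + (-1 - ((t : ℕ) : ZMod (2 * n + 1))) + 1 := by ring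
    have e3 : r + -(((t : ℕ) : ZMod (2 * n + 1)) + 1) = r + (-1 - ((t : ℕ) : ZMod (2 * n + 1))) := by ring
    rw [e1, e2, e3, det_one_add_pow_rotate₄ (W _)ᴴ, det_one_add_pow_rotate₄ (M _)]

end RouteBAlgebra

open RouteBAlgebra in
/-- **Helper stub `routeBAlgebra` (Route B abstract chain of `stub_heavyFrequencyGain`; line `Sketch`,
crux stmt-QuantumFields-9734).** For positive definite `M_i` and unitary `W_i` on `ZMod (2n+1)` (`n ≥ 1`) and
every reflection row `r`:
`(‖det (1 + ∏_{i<2n+1} M_i W_i)‖²)^n ≤ (p(M_{r+n}) p(M_{r+n+1}))^n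
  · ∏_{t<n} Re det (1 + (W_{r+t}ᴴ M_{r+t} W_{r+t} M_{r+t+1})^n) · ∏_{t<n} Re det (1 + (W_uᴴ M_u W_u M_{u+1})^n)_{u = r+n+1+t}`,
`p(M) = ∏ᵢ max(μᵢ(M), 1)`:
rotate the cyclic word to row `r` (`det_one_add_prod_rotate`), apply the mixed Schwarz inequality
`mixedSchwarzDet`, and bound the two reflected words by `routeBPlusChain` (the `−` word being the `+` word of the
reflected data, `minusChain`). -/
theorem routeBAlgebra : ∀ {k : Type} [Fintype k] [DecidableEq k] (n : ℕ), 0 < n →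
    ∀ (M : ZMod (2 * n + 1) → Matrix k k ℂ) (hM : ∀ i, (M i).PosDef)
      (W : ZMod (2 * n + 1) → Matrix k k ℂ), (∀ i, W i ∈ Matrix.unitaryGroup k ℂ) → ∀ r : ZMod (2 * n + 1),
    (‖(1 + ((List.range (2 * n + 1)).map fun i : ℕ =>
        M (i : ZMod (2 * n + 1)) * W (i : ZMod (2 * n + 1))).prod).det‖ ^ 2) ^ n ≤
      ((∏ i, max ((hM (r + n)).posSemidef.1.eigenvalues i) 1) *
          (∏ i, max ((hM (r + n + 1)).posSemidef.1.eigenvalues i) 1)) ^ n *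
        (∏ t : Fin n, ((1 + ((W (r + t))ᴴ * M (r + t) * W (r + t) * M (r + t + 1)) ^ n).det).re) *
        (∏ t : Fin n, ((1 + ((W (r + n + 1 + t))ᴴ * M (r + n + 1 + t) * W (r + n + 1 + t) *
          M (r + n + 1 + t + 1)) ^ n).det).re) := by
  intro k _ _ n hn M hM W hW r
  -- rotate to row `r` and apply the mixed Schwarz inequality
  have hS := mixedSchwarzDet n (fun j => M (r + j)) (fun j => hM (r + j)) (fun j => W (r + j)) (fun j => hW (r + j))
  have hrot := det_one_add_prod_rotate (fun j => M j * W j) r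
  rw [← hrot] at hS
  -- the two half chains
  have hP := routeBPlusChain n hn (fun j => M (r + j)) (fun j => hM (r + j)) (fun j => W (r + j)) (fun j => hW (r + j))
  have hQ := minusChain n hn M hM W hW r
  have hPQ := mul_le_mul hP hQ (pow_nonneg (norm_nonneg _) n) ((pow_nonneg (norm_nonneg _) n).trans hP)
  rw [← mul_pow] at hPQ
  have h := (pow_le_pow_left₀ (sq_nonneg _) hS n).trans hPQ
  refine h.trans (le_of_eq ?_)
  rw [mul_pow, Fin.prod_univ_eq_prod_range (fun t : ℕ => ((1 + ((W (r + t))ᴴ * M (r + t) * W (r + t) *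
    M (r + (t + 1))) ^ n).det).re) n, Fin.prod_univ_eq_prod_range (fun t : ℕ => ((1 + ((W (r + t))ᴴ *
    M (r + t) * W (r + t) * M (r + t + 1)) ^ n).det).re) n]
  simp only [add_assoc]
  ring

end Summit.QuantumFields.QCD.Cruxes.CriticalLineDiamagnetism.ChessboardCellGain
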